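import Literature.Topology.Immersions.HirschImmersionParallelizableProduct
import Literature.Topology.FourManifolds.ImmersedHypersurfaceStablyParallelizable
import HarnessLib

/-!
# Stably parallelizable manifolds immerse in codimension one (Hirsch; Kervaire–Milnor §3)

Topic `Literature/Topology/Immersions`. M. W. Hirsch, *Immersions of manifolds*, Trans. Amer.
Math. Soc. 93 (1959), Thm. 6.3 / Cor. 6.4 (the case `k = 1`): an `n`-manifold immerses in `ℝⁿ⁺¹`
iff it is *s-parallelizable* (`TM ⊕ ε¹` trivial; Kervaire–Milnor, *Groups of homotopy spheres I*
(1963), §3, p. 508, and Milnor–Stasheff §2: "π-manifolds"). The tree proves the direction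
"immersion `⇒` s-parallelizable" for oriented manifolds
(`Literature.Topology.FourManifolds.isStablyParallelizable_of_immersion_succ`,
`ImmersedHypersurfaceStablyParallelizable.lean`); here we **prove the converse** from the tree's
Phillips theorem through `exists_immersion_of_isParallelizable_prod`
(`HirschImmersionParallelizableProduct.lean`):

* `isParallelizable_prod_line_of_isStablyParallelizable` — a stable framing of `TM` (tree's
  `IsStablyParallelizable`: `dim M + 1` continuous pointwise independent sections of `TM ⊕ ℝ`) is a
  parallelization of `M × ℝ` (Mathlib's `equivTangentBundleProd`: `T(M × ℝ) ≅ TM × Tℝ`);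
* `exists_immersion_succ_of_isStablyParallelizable` — **an s-parallelizable `n`-manifold
  (Hausdorff, second countable) immerses in `ℝⁿ⁺¹`**;
* `isStablyParallelizable_iff_exists_immersion_succ` — for smoothly oriented `M`, the equivalence
  with the tree's converse.

Everything here is proved; no named facts are introduced (D-0026).

## References

* M. W. Hirsch, *Immersions of manifolds*, Trans. Amer. Math. Soc. 93 (1959), 242–276, §6
  (Thm. 6.3, Cor. 6.4). [Hirsch1959]
* M. Kervaire, J. Milnor, *Groups of homotopy spheres I*, Ann. of Math. 77 (1963), §3, p. 508
  (s-parallelizable manifolds). [KervaireMilnorAnnals1963]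
* A. Phillips, *Submersions of open manifolds*, Topology 6 (1967), Cor. 8.2. [Phillips1967]
-/

open scoped Manifold ContDiff Topology
open Set Function Module Bundle

noncomputable section

namespace Literature.Topology.Immersions

/-- Local notation: `𝔼 n` is the model Euclidean space `EuclideanSpace ℝ (Fin n)`. -/
local notation "𝔼 " n:arg => EuclideanSpace ℝ (Fin n)

open Literature.Topology.FourManifolds (IsParallelizable IsStablyParallelizable SmoothOrientation
  isStablyParallelizable_of_immersion_succ)

variable {n : ℕ}

/-- The unit vector `e₀` of `ℝ¹`. [folklore] -/
def lineUnit : 𝔼 1 := EuclideanSpace.single 0 1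

/-- `e₀ ≠ 0`. [folklore] -/
theorem lineUnit_ne_zero : lineUnit ≠ 0 := by
  intro h
  have := congrArg (fun v : 𝔼 1 => v 0) h
  simp [lineUnit] at this

/-- The linear map `(v, c) ↦ (v, c e₀) : ℝⁿ × ℝ → ℝⁿ × ℝ¹` is injective. [folklore] -/
theorem injective_prodMap_toSpanSingleton :
    Injective (LinearMap.prodMap (LinearMap.id : 𝔼 n →ₗ[ℝ] 𝔼 n)
      (LinearMap.toSpanSingleton ℝ (𝔼 1) lineUnit)) := by
  rintro ⟨v, c⟩ ⟨v', c'⟩ h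
  simp only [LinearMap.prodMap_apply, LinearMap.id_apply, LinearMap.toSpanSingleton_apply,
    Prod.mk.injEq] at h
  obtain ⟨rfl, h2⟩ := h
  have : c = c' := smul_left_injective ℝ lineUnit_ne_zero h2
  rw [this]

/-- **A stable framing of `TM` is a parallelization of `M × ℝ`**: the sections
`(x, t) ↦ (sᵢ(x)_E, sᵢ(x)_ℝ · e₀)` of `T(M × ℝ) = TM × Tℝ` (Mathlib's `equivTangentBundleProd`) are
continuous and pointwise linearly independent. [cite: KervaireMilnorAnnals1963, §3 p. 508] -/
theorem isParallelizable_prod_line_of_isStablyParallelizable {M : Type*} [TopologicalSpace M]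
    [ChartedSpace (𝔼 n) M] [IsManifold (𝓡 n) 1 M] (h : IsStablyParallelizable (𝓡 n) M) :
    IsParallelizable ((𝓡 n).prod (𝓡 1)) (M × 𝔼 1) := by
  obtain ⟨s, hs1, hs2, hli⟩ := h
  have hrank : finrank ℝ (𝔼 n × 𝔼 1) = finrank ℝ (𝔼 n) + 1 := by
    simp [Module.finrank_prod]
  let e : Fin (finrank ℝ (𝔼 n × 𝔼 1)) ≃ Fin (finrank ℝ (𝔼 n) + 1) := finCongr hrank
  refine ⟨fun i p => ((s (e i) p.1).1, (s (e i) p.1).2 • lineUnit), fun i => ?_, fun p => ?_⟩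
  · -- continuity, through `T(M × ℝ) ≅ TM × Tℝ`
    have hA : Continuous fun p : M × 𝔼 1 =>
        (TotalSpace.mk' (𝔼 n) p.1 (s (e i) p.1).1 : TangentBundle (𝓡 n) M) :=
      (hs1 (e i)).comp continuous_fst
    have hB : Continuous fun p : M × 𝔼 1 =>
        (TotalSpace.mk' (𝔼 1) p.2 ((s (e i) p.1).2 • lineUnit) : TangentBundle (𝓡 1) (𝔼 1)) := by
      have hh := (tangentBundleModelSpaceHomeomorph (I := 𝓡 1) (H := 𝔼 1)).symm.continuous
      have hdata : Continuous fun p : M × 𝔼 1 =>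
          ((p.2, (s (e i) p.1).2 • lineUnit) : ModelProd (𝔼 1) (𝔼 1)) :=
        continuous_snd.prodMk (((hs2 (e i)).comp continuous_fst).smul continuous_const)
      exact hh.comp hdata
    have hC := (contMDiff_equivTangentBundleProd_symm (n := 0) (I := 𝓡 n) (M := M) (I' := 𝓡 1)
      (M' := 𝔼 1)).continuous
    exact hC.comp (hA.prodMk hB)
  · -- pointwise linear independence
    have h1 : LinearIndependent ℝ fun i => s (e i) p.1 := (hli p.1).comp e e.injective
    have h2 := h1.map' _ (LinearMap.ker_eq_bot.2 (injective_prodMap_toSpanSingleton (n := n)))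
    simpa [Function.comp_def] using h2

/-- **Stably parallelizable manifolds immerse in codimension one** (Hirsch 1959, Thm. 6.3 with
`k = 1`; from Phillips' theorem): an s-parallelizable `n`-manifold `M` (Hausdorff, second countable)
admits a `C^∞` map `g : M → ℝⁿ⁺¹` with everywhere injective differential.
[cite: Hirsch1959, Thm. 6.3; Phillips1967, Cor. 8.2] -/
theorem exists_immersion_succ_of_isStablyParallelizable {M : Type} [TopologicalSpace M] [T2Space M]
    [SecondCountableTopology M] [ChartedSpace (𝔼 n) M] [IsManifold (𝓡 n) ∞ M]
    (h : IsStablyParallelizable (𝓡 n) M) :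
    ∃ g : M → 𝔼 (n + 1), ContMDiff (𝓡 n) (𝓡 (n + 1)) ∞ g ∧
      ∀ x, Injective (mfderiv (𝓡 n) (𝓡 (n + 1)) g x) :=
  exists_immersion_of_isParallelizable_prod le_rfl (isParallelizable_prod_line_of_isStablyParallelizable h)

/-- **Hirsch's criterion in codimension one, oriented case**: a smoothly oriented `n`-manifold
(Hausdorff, second countable) is stably parallelizable iff it immerses smoothly in `ℝⁿ⁺¹` — the
converse direction being the tree's `isStablyParallelizable_of_immersion_succ` (the oriented unit
normal splits `ℝⁿ⁺¹ = dF(TM) ⊕ ℝ`). [cite: Hirsch1959, Thm. 6.3 and Cor. 6.4; KervaireMilnorAnnals1963, §3 p. 508] -/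
theorem isStablyParallelizable_iff_exists_immersion_succ {M : Type} [TopologicalSpace M]
    [T2Space M] [SecondCountableTopology M] [ChartedSpace (𝔼 n) M] [IsManifold (𝓡 n) ∞ M]
    (o : SmoothOrientation (𝓡 n) M) :
    IsStablyParallelizable (𝓡 n) M ↔ ∃ g : M → 𝔼 (n + 1), ContMDiff (𝓡 n) (𝓡 (n + 1)) ∞ g ∧
      ∀ x, Injective (mfderiv (𝓡 n) (𝓡 (n + 1)) g x) := by
  refine ⟨exists_immersion_succ_of_isStablyParallelizable, ?_⟩
  rintro ⟨g, hg, hinj⟩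
  exact isStablyParallelizable_of_immersion_succ o (hg.of_le (by simp)) hinj

end Literature.Topology.Immersions
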